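import Summits.Schanuel.Schanuel.Theorems.RootDecomp1KSectorSubspace01

/-!
# RootDecomp1KSectorSubspace — lens 1, generation 70, NODE 30 «THE (4,2)-SECTOR BOX WITH SIMPLE EDGE ROOTS IS SUBSPACE» (×0-AS-RECORD, CONDITIONAL LANE — PRICE L3112, RULING L3115 (4); CLAIM L3110, NODE L3125, VERDICT L3131): for the (4,2)-sector box `boxP q` = (Y⁴ + δY³ + ζ₂Y² + ζ₁Y + ζ₀) + x·(αY² + βY + ε) + γ·x² with γ ODD and the edge quartic W⁴ + αW² + γ SEPARABLE, WINDOW LEVEL-FINITENESS and hence `LevelFinite` / `ThinFibreAt m₀` for every m₀ MODULO the route's existing binder `PadicSubspace` (hypothesis `hS`, never an axiom): `window_levels_finite`, `levelFinite_box_of_padicSubspace`, `thinFibreAt_box_of_padicSubspace`; node 11's second-order Subspace lever (tree `Lform` / `Mform` / `nearest_root` / `isAlgebraic_corr` BY NAME) transplanted to the (∞,∞) sector and closed by `transcendental_liouvilleNumber`; (H7) the GENERIC member (separable Δ_x) is node 23's — `thinFibreAt_box_of_separable_pDisc` hypothesis-free, `domHyper_box_iff`, `thinFibreAt_box_dichotomy`;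 consistency probe ρ1 (`thinFibreAt_rho1_of_padicSubspace`, unconditional by node 28); specimen M30 = (Y⁴ − Y³ − 6Y² + 2Y + 15) + x·(4Y² + Y − 27) + 11x² (singular at (1,1), ¬DomHyper, not split in the given coordinates, split after translation): `thinFibreAt_m30_of_padicSubspace` — continuation (RootDecomp1KSectorSubspace02): # §2  The sector in `ℂ₂`: the level to second order at a simple root of the edge quartic · # §3  The integer vector `x = (num r, 1, den r)` and the forms (tree `Lform`, `Mform` BY NAME) · # §4  The exponent inequality of the sector (`q = 2`) · # §5  Closing: finitely many LEVELS per rational subspace (no Diophantine input) — 16 declarations `level_shape` … `sector_arith`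

(lens-1 g70 NODE 30 «THE (4,2)-SECTOR BOX WITH SIMPLE EDGE ROOTS IS SUBSPACE» L3125: HOME kernel K = HOME/decomp-schanuel-lens-1/g70/lean/SectorSubspace.lean sha256 30de2f8e…, 1334 l, 87 decls (78 theorems + 8 defs + 1 structure `SectorBox`), ONE namespace `Summit.Schanuel.Schanuel.Theorems.RootDecomp1KSectorSubspace`, imports the tree port …RootDecomp1KExhibitDescent03 ONLY (node 29's record port; `PadicSubspace` / `Lform` / `Mform` / `nearest_root` / `isAlgebraic_corr` (SubspaceBranch), `rho1` (SectorTheorem), `pDisc` / `DomHyper` / `thinFibreAt_dom2` (HyperellipticSiegel), `thinFibreAt_of_levelFinite`, `tendsto_partialSum_two` BY TREE NAME); no private / instance / set_option / notation / sorry / new axiom; the binder `PadicSubspace` appears ONLY as the hypothesis `hS` of the `…_of_padicSubspace` heads; lens farm rc 0 · 0 errors · 0 sorries · 99 dupNamespace, `--axioms` standard on 13 heads, Probe g70/out/Probe.lean e9bf9f63… rc 0 (rfl pins @PadicSubspace = tree, @rho1 = tree, @pDisc / @DomHyper / @LevelFinite = tree), CONTROL ProbeCtrl ec7805c4… rc 1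 as designed, memo g70/NODE-g70.md 51b8502c…, SHA256SUMS 23/23; CLAIM L3110 (ASK-FIRST; conditional class theorem, no new binder, no exhibit); crit g12 PRICE 30 L3112: ×0-AS-RECORD, PORT WELCOME (conditional lane, like W4Dossier01 — K-R56 (ii)/(iii), the W4 precedent RULING L2988, K-R58 (iii): the binder PROVED is the one payable head), CHECKLIST K-g70 (H1)–(H6) + (S), W-30-1; writer g36 NOTE 4 L3113 (arithmetic pre-check 11/11 on 122 472 cleared quartics); census INSTRUMENT NOTE 48 L3114 (CE-25-1: the residue exhibits of record were DomHyper) and crit RULING L3115 ((3) ERRATUM E7 FIXED; (4) PRICE 30 REFINED: the box ∩ {{Δ_x separable}} is ALREADY DECIDED UNCONDITIONALLY by node 23's `thinFibreAt_dom2`, node 30's proper conditional reach = the SINGULAR members (α)/(β), CHECKLIST += (H7)); writer NOTE 5 L3123 (exhaustive box census 15 309: separable 14 498 / inseparable 811); census LIVENESS-v43 key box30 (rows 63 rho1 / 70 ρ1′ / 73 specimen); crit g13 VERDICT 30 L3131: «×0-AS-RECORD — BOOKED as priced (PRICE L3112, RULING L3115 (4)); CHECKLIST K-g70 (H1)–(H7)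 + (S) MET; NO objection to any kernel statement; three errata-lite in PROSE only (e30-2 lens, e30-3 writer, CE-25-2 census), all on the abscissa convention — zero kernel and zero record consequence; decl census 90 = 81 theorems + 8 defs + 1 structure (the three @[simp] lemmas svec_zero/one/two counted); --axioms on 33 heads standard, PadicSubspace ONLY as the explicit binder hS; RECORD AT VERDICT 30: Dom(PadicSubspace) map entry := {node 11 SepTopAt classes, W4, node-30 box ∖ DomHyper}, the DomHyper part printed in the UNCONDITIONAL lane as node 23 (H7); open territory / exhibits VACANT / ledger / tally UNCHANGED; PORT GO (conditional lane, W4Dossier01 precedent; every …_of_padicSubspace head keeps (hS : PadicSubspace) explicit; statements byte-verbatim to K; e30-2 docstring clause at the census choice — carried VERBATIM here, e30-2 standing in the errata list)». PORT-SIDE MODIFIER (bounce p850098, dedup.landed): K l.607 abs_num_eq ≡ tree RootDecomp1EPointTransfer.abs_num_eq ⇒ PRIVATE in part 02 + a private copy in part 03 (one use each), statements / proofs = K. Port by census-1 gen 25 as `RootDecomp1KSectorSubspace01–05` (files ≤ 400 lines; `--supports stmt-Schanuel-33364`, the item stays OPEN; ×0 record port in the CONDITIONAL lane — every `…_of_padicSubspace`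 head carries the hypothesis `hS : PadicSubspace` explicitly (W4Dossier01 precedent); no credit anywhere; record effect at VERDICT 30 = the MAP entry Dom(PadicSubspace) ∪= node-30 box ∖ DomHyper, the DomHyper part in the unconditional lane (node 23)): 01 = K l.1–384 of the prepped source (opens # §0 / # §1) — 25 decls `norm_two_ss`, `norm_two_pow_ss`, `norm_intCast_le_one_ss`, …, `eventually_K₀_small_ss`; 02 = K l.385–691 of the prepped source (opens # §2 / # §3 / # §4 / # §5) — 16 decls `level_shape`, `level_padic`, `first_order`, …, `sector_arith`; 03 = K l.692–1012 of the prepped source (opens # §6) — 11 decls `bev_boxP_liouville_ne_zero`, `no_point_near`, `level_le_two_mul_pow`, …, `thinFibreAt_box_of_padicSubspace'`; 04 = K l.1013–1333 of the prepped source (opens # §7 / # §8 / # §9) — 37 decls `level_second_order`, `rho1Box`, `boxC_rho1Box`, …, `domHyper_box_iff`; 05 = K l.1334–1343 of the prepped source (inside # §9) — 1 decls `thinFibreAt_box_dichotomy`. 0 one-line docstrings synthesised for undocumented helper declarations (statements quoted); everything else = K VERBATIM (statements, names, proofs, K's module docstring kept in part 01 below this provenance block).)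
-/

noncomputable section

namespace Summit.Schanuel.Schanuel.Theorems.RootDecomp1KSectorSubspace

open Polynomial LiouvilleNumber
open scoped Nat
open Summit.Schanuel.Schanuel.Theorems.RootDecomp1KTwoBaseCell (psNumer partialSum_eq_psNumer_div coprime_psNumer)
open Summit.Schanuel.Schanuel.Theorems.RootDecomp1KRelLiouvilleCell (partialSum_two_strictMono)
open Summit.Schanuel.Schanuel.Theorems.RootDecomp1KDegreeLadder
open Summit.Schanuel.Schanuel.Theorems.RootDecomp1KXLinearCore
open Summit.Schanuel.Schanuel.Theorems.RootDecomp1KXLinear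
open Summit.Schanuel.Schanuel.Theorems.RootDecomp1KXLinearII
open Summit.Schanuel.Schanuel.Theorems.RootDecomp1KXTop
open Summit.Schanuel.Schanuel.Theorems.RootDecomp1KSubspaceBranch
open Summit.Schanuel.Schanuel.Theorems.RootDecomp1KDigitPincer (odd_psNumer_two)
open Summit.Schanuel.Schanuel.Theorems.RootDecomp1KSectorTheorem (rho1 tendsto_partialSum_two)
open Summit.Schanuel.Schanuel.Theorems.RootDecomp1KHyperellipticSiegel (pDisc DomHyper domHyper_xPolyP_iff thinFibreAt_dom2 levelFinite_dom2)
open Summit.Schanuel.Schanuel.Theorems.RootDecomp1KIntegrality (DomZero)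
open Summit.Schanuel.Schanuel.Theorems.RootDecomp1KLevelFinite (LevelSet LevelFinite thinFibreAt_of_levelFinite)
open Summit.Schanuel.Schanuel.Theorems.RootDecomp1KHeightGrading (BddLevelEmpty bddLevelEmpty_iff_levelFinite)

/-- **the level SHAPE at `x = s_N`**: for `γ` odd, `N ≥ 2`, `2m = N!`, a rational point `r` of level `N` of the box
has `den r = 2^m`, `num r` odd, and `num r` solves the reduced equation `redLHS q N m (num r) = 0`. -/
theorem level_shape (q : SectorBox) (hγ : Odd q.γ) {N m : ℕ} (hN : 2 ≤ N) (hm : 2 * m = N !) {r : ℚ}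
    (hP : bev (boxP q) (partialSum 2 N) r = 0) :
    (r.den : ℤ) = 2 ^ m ∧ Odd r.num ∧ redLHS q N m r.num = 0 := by
  have hs : partialSum 2 N = ((psNumer 2 N : ℤ) : ℝ) / 2 ^ (2 * m) := by
    have h := partialSum_eq_psNumer_div (b := 2) (by norm_num) N
    rw [hm]
    push_cast at h ⊢
    simpa using h
  rw [hs] at hP
  have hint := int_eq9 q (psNumer 2 N : ℤ) m r hP
  have hp : Odd (psNumer 2 N : ℤ) := odd_psNumer_two (by omega)
  obtain ⟨hm1, -, -, -⟩ := level_exponents hN hm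
  exact shape9 q hγ hp hm1 hint

/-! ### §2  The sector in `ℂ₂`: the level to second order at a simple root of the edge quartic -/

/-- **(§2.1) THE LEVEL IN `ℂ₂`**: on a level `N ≥ 2` (`2m = N!`) the reduced equation gives
`‖f(W) + 2^m·g(W)‖₂ ≤ 2^{−(N! − (N−1)!)}` — the terms `ζ₂2^{2m}W², ζ₁2^{3m}W, ζ₀2^{4m}, εp2^{2m}` are
`O(2^{−2m})` and `p_N ≡ 1 (mod 2^{N!−(N−1)!})` (tree `norm_psNumer_sub_one`) turns `αpW², βp2^mW, γp²` into
`αW², β2^mW, γ`. -/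
theorem level_padic (q : SectorBox) {N m : ℕ} (hN : 2 ≤ N) (hm : 2 * m = N !) {a : ℤ} (hred : redLHS q N m a = 0) :
    ‖aeval (a : PadicAlgCl 2) (edgeF q) + (2 : PadicAlgCl 2) ^ m * aeval (a : PadicAlgCl 2) (subG q)‖ ≤
      (1 / 2 : ℝ) ^ ((N !) - (N - 1)!) := by
  obtain ⟨hm1, hmE, hE2, -⟩ := level_exponents hN hm
  unfold redLHS at hred
  have hcast : (a : PadicAlgCl 2) ^ 4 + (q.δ : PadicAlgCl 2) * (2 : PadicAlgCl 2) ^ m * (a : PadicAlgCl 2) ^ 3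
      + (q.ζ₂ : PadicAlgCl 2) * ((2 : PadicAlgCl 2) ^ m) ^ 2 * (a : PadicAlgCl 2) ^ 2
      + (q.ζ₁ : PadicAlgCl 2) * ((2 : PadicAlgCl 2) ^ m) ^ 3 * (a : PadicAlgCl 2)
      + (q.ζ₀ : PadicAlgCl 2) * ((2 : PadicAlgCl 2) ^ m) ^ 4
      + (q.α : PadicAlgCl 2) * (psNumer 2 N : PadicAlgCl 2) * (a : PadicAlgCl 2) ^ 2
      + (q.β : PadicAlgCl 2) * (psNumer 2 N : PadicAlgCl 2) * (2 : PadicAlgCl 2) ^ m * (a : PadicAlgCl 2)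
      + (q.ε : PadicAlgCl 2) * (psNumer 2 N : PadicAlgCl 2) * ((2 : PadicAlgCl 2) ^ m) ^ 2
      + (q.γ : PadicAlgCl 2) * (psNumer 2 N : PadicAlgCl 2) ^ 2 = 0 := by
    have h := congrArg (Int.cast : ℤ → PadicAlgCl 2) hred
    push_cast at h
    linear_combination h
  set P : PadicAlgCl 2 := (psNumer 2 N : PadicAlgCl 2) with hPdef
  set T : PadicAlgCl 2 := (2 : PadicAlgCl 2) ^ m with hTdef
  set W : PadicAlgCl 2 := (a : PadicAlgCl 2) with hWdef
  set η : ℝ := (1 / 2 : ℝ) ^ ((N !) - (N - 1)!) with hη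
  have hη0 : 0 ≤ η := by positivity
  have hid : aeval W (edgeF q) + T * aeval W (subG q) =
      -((q.ζ₂ : PadicAlgCl 2) * T ^ 2 * W ^ 2 + (q.ζ₁ : PadicAlgCl 2) * T ^ 3 * W
        + (q.ζ₀ : PadicAlgCl 2) * T ^ 4 * 1
        + (q.α : PadicAlgCl 2) * (P - 1) * W ^ 2 + (q.β : PadicAlgCl 2) * (P - 1) * (T * W)
        + (q.ε : PadicAlgCl 2) * P * T ^ 2 * 1 + (q.γ : PadicAlgCl 2) * (P - 1) * (P + 1)) := by
    rw [aeval_edgeF, aeval_subG]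
    linear_combination hcast
  -- the sizes
  have hT : ‖T‖ = (1 / 2 : ℝ) ^ m := by rw [hTdef, norm_two_pow_ss]
  have hT1 : ‖T‖ ≤ 1 := by rw [hT]; exact pow_le_one₀ (by norm_num) (by norm_num)
  have hTk1 : ∀ k : ℕ, ‖T ^ k‖ ≤ 1 := fun k => by rw [norm_pow]; exact pow_le_one₀ (norm_nonneg _) hT1
  have hT2 : ‖T ^ 2‖ ≤ η := by
    rw [norm_pow, hT, ← pow_mul, hη]
    exact pow_le_pow_of_le_one (by norm_num) (by norm_num) (by omega)
  have hTk : ∀ k : ℕ, ‖T ^ (2 + k)‖ ≤ η := fun k => by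
    rw [pow_add, norm_mul]
    calc ‖T ^ 2‖ * ‖T ^ k‖ ≤ η * 1 := by gcongr; exact hTk1 k
      _ = η := mul_one _
  have hT3 : ‖T ^ 3‖ ≤ η := hTk 1
  have hT4 : ‖T ^ 4‖ ≤ η := hTk 2
  have hP1 : ‖P - 1‖ ≤ η := by rw [hPdef, hη]; exact norm_psNumer_sub_one (by omega)
  have hPle : ‖P‖ ≤ 1 := norm_natCast_le_one_ss _
  have hone : ‖(1 : PadicAlgCl 2)‖ ≤ 1 := by rw [norm_one]
  have hP1' : ‖P + 1‖ ≤ 1 := ultra_add hPle hone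
  have hW : ‖W‖ ≤ 1 := norm_intCast_le_one_ss a
  have hWk : ∀ k : ℕ, ‖W ^ k‖ ≤ 1 := fun k => by rw [norm_pow]; exact pow_le_one₀ (norm_nonneg _) hW
  have hTW : ‖T * W‖ ≤ 1 := by rw [norm_mul]; exact mul_le_one₀ hT1 (norm_nonneg _) hW
  have hεP : ‖(q.ε : PadicAlgCl 2) * P‖ ≤ 1 := by
    rw [norm_mul]; exact mul_le_one₀ (norm_intCast_le_one_ss _) (norm_nonneg _) hPle
  have h1 : ‖(q.ζ₂ : PadicAlgCl 2) * T ^ 2 * W ^ 2‖ ≤ η := norm_mul3_le (norm_intCast_le_one_ss _) hT2 (hWk 2) hη0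
  have h2 : ‖(q.ζ₁ : PadicAlgCl 2) * T ^ 3 * W‖ ≤ η := norm_mul3_le (norm_intCast_le_one_ss _) hT3 hW hη0
  have h3 : ‖(q.ζ₀ : PadicAlgCl 2) * T ^ 4 * 1‖ ≤ η := norm_mul3_le (norm_intCast_le_one_ss _) hT4 hone hη0
  have h4 : ‖(q.α : PadicAlgCl 2) * (P - 1) * W ^ 2‖ ≤ η := norm_mul3_le (norm_intCast_le_one_ss _) hP1 (hWk 2) hη0
  have h5 : ‖(q.β : PadicAlgCl 2) * (P - 1) * (T * W)‖ ≤ η := norm_mul3_le (norm_intCast_le_one_ss _) hP1 hTW hη0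
  have h6 : ‖(q.ε : PadicAlgCl 2) * P * T ^ 2 * 1‖ ≤ η := norm_mul3_le hεP hT2 hone hη0
  have h7 : ‖(q.γ : PadicAlgCl 2) * (P - 1) * (P + 1)‖ ≤ η := norm_mul3_le (norm_intCast_le_one_ss _) hP1 hP1' hη0
  rw [hid, norm_neg]
  exact ultra_add (ultra_add (ultra_add (ultra_add (ultra_add (ultra_add h1 h2) h3) h4) h5) h6) h7

/-- **(§2.2) FIRST ORDER**: `‖f(W)‖₂ ≤ 2^{−m}` — `W` is `2^{−m}`-close to a root of the edge quartic. -/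
theorem first_order (q : SectorBox) {N m : ℕ} (hN : 2 ≤ N) (hm : 2 * m = N !) {a : ℤ} (hred : redLHS q N m a = 0) :
    ‖aeval (a : PadicAlgCl 2) (edgeF q)‖ ≤ (1 / 2 : ℝ) ^ m := by
  obtain ⟨hm1, hmE, hE2, -⟩ := level_exponents hN hm
  have h := level_padic q hN hm hred
  have hη : (1 / 2 : ℝ) ^ ((N !) - (N - 1)!) ≤ (1 / 2 : ℝ) ^ m :=
    pow_le_pow_of_le_one (by norm_num) (by norm_num) hmE
  have hW : ‖(a : PadicAlgCl 2)‖ ≤ 1 := norm_intCast_le_one_ss a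
  have hg : ‖(2 : PadicAlgCl 2) ^ m * aeval (a : PadicAlgCl 2) (subG q)‖ ≤ (1 / 2 : ℝ) ^ m := by
    rw [norm_mul, norm_two_pow_ss]
    have h1 : ‖aeval (a : PadicAlgCl 2) (subG q)‖ ≤ 1 := by
      refine (norm_aeval_le (subG q) _).trans ?_
      rw [max_eq_left hW, one_pow]
    calc (1 / 2 : ℝ) ^ m * ‖aeval (a : PadicAlgCl 2) (subG q)‖ ≤ (1 / 2 : ℝ) ^ m * 1 := by gcongr
      _ = _ := mul_one _
  have hid : aeval (a : PadicAlgCl 2) (edgeF q) =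
      (aeval (a : PadicAlgCl 2) (edgeF q) + (2 : PadicAlgCl 2) ^ m * aeval (a : PadicAlgCl 2) (subG q)) -
        (2 : PadicAlgCl 2) ^ m * aeval (a : PadicAlgCl 2) (subG q) := by ring
  rw [hid]
  exact ultra_sub (h.trans hη) hg

/-- **(§2.3) SECOND ORDER AT A SIMPLE EDGE ROOT `ξ`**: there is `K = K(q, ξ, K₀) > 0` such that on every level
`N ≥ 2` (`2m = N!`) every odd numerator `a` with `‖a − ξ‖₂ ≤ K₀·2^{−m}` (and `≤ 1`) satisfies
`‖(a − ξ) + 2^m·γ_ξ‖₂ ≤ K·2^{−(N!−(N−1)!)}`, `γ_ξ := g(ξ)/f′(ξ)`: `a` approximates the MOVING algebraic target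
`ξ − 2^m γ_ξ` to twice the order (`γ_ξ ∈ ℚ(ξ)` algebraic, in general irrational). -/
theorem second_order (q : SectorBox) {ξ : PadicAlgCl 2} (hξ : aeval ξ (edgeF q) = 0)
    (ht : aeval ξ (derivative (edgeF q)) ≠ 0) (K₀ : ℝ) (hK₀ : 1 ≤ K₀) :
    ∃ K : ℝ, 0 < K ∧ ∀ N m : ℕ, 2 ≤ N → 2 * m = N ! → ∀ a : ℤ, redLHS q N m a = 0 →
      ‖(a : PadicAlgCl 2) - ξ‖ ≤ K₀ * (1 / 2 : ℝ) ^ m → ‖(a : PadicAlgCl 2) - ξ‖ ≤ 1 →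
      ‖((a : PadicAlgCl 2) - ξ) + (2 : PadicAlgCl 2) ^ m * (aeval ξ (subG q) / aeval ξ (derivative (edgeF q)))‖ ≤
        K * (1 / 2 : ℝ) ^ ((N !) - (N - 1)!) := by
  set Mξ : ℝ := max 1 ‖ξ‖ with hMξ
  have hMξ1 : 1 ≤ Mξ := le_max_left _ _
  set t₁ : PadicAlgCl 2 := aeval ξ (derivative (edgeF q)) with ht₁
  set g : PadicAlgCl 2 := aeval ξ (subG q) with hg
  have htpos : 0 < ‖t₁‖ := norm_pos_iff.mpr ht
  set A : ℝ := Mξ ^ 4 * K₀ ^ 2 + Mξ ^ 3 * K₀ + 1 with hA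
  have hA1 : 1 ≤ A := by
    have : (0 : ℝ) ≤ Mξ ^ 4 * K₀ ^ 2 + Mξ ^ 3 * K₀ := by positivity
    rw [hA]; linarith
  refine ⟨A / ‖t₁‖, by positivity, fun N m hN hm a hred hδ hδ1 => ?_⟩
  obtain ⟨hm1, hmE, hE2, -⟩ := level_exponents hN hm
  set z : PadicAlgCl 2 := (a : PadicAlgCl 2) with hz
  set T : PadicAlgCl 2 := (2 : PadicAlgCl 2) ^ m with hT
  set η : ℝ := (1 / 2 : ℝ) ^ ((N !) - (N - 1)!) with hη
  have hη0 : 0 ≤ η := by positivity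
  have hTn : ‖T‖ = (1 / 2 : ℝ) ^ m := by rw [hT, norm_two_pow_ss]
  have h2m : (1 / 2 : ℝ) ^ m * (1 / 2 : ℝ) ^ m ≤ η := by
    rw [← pow_add, hη]; exact pow_le_pow_of_le_one (by norm_num) (by norm_num) (by omega)
  set B : ℝ := A * η with hB
  -- (1) the level to second order
  have h1 : ‖aeval z (edgeF q) + T * aeval z (subG q)‖ ≤ B := by
    have h := level_padic q hN hm hred
    refine h.trans ?_
    rw [hB]; exact le_mul_of_one_le_left hη0 hA1
  -- (2) the Taylor remainder of `f` at `ξ` to order two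
  have h2 : ‖aeval z (edgeF q) - t₁ * (z - ξ)‖ ≤ B := by
    have h := norm_sub_taylor_two_le (edgeF q) ξ z hδ1
    rw [hξ, sub_zero, natDegree_edgeF] at h
    refine h.trans ?_
    calc Mξ ^ 4 * ‖z - ξ‖ ^ 2 ≤ Mξ ^ 4 * (K₀ * (1 / 2 : ℝ) ^ m) ^ 2 := by gcongr
      _ = Mξ ^ 4 * K₀ ^ 2 * ((1 / 2 : ℝ) ^ m * (1 / 2 : ℝ) ^ m) := by ring
      _ ≤ Mξ ^ 4 * K₀ ^ 2 * η := by gcongr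
      _ ≤ A * η := by
          refine mul_le_mul_of_nonneg_right ?_ hη0
          have : (0 : ℝ) ≤ Mξ ^ 3 * K₀ + 1 := by positivity
          rw [hA]; linarith
  -- (3) the Taylor remainder of `g` at `ξ` to order one, times `2^m`
  have h3 : ‖T * (aeval z (subG q) - g)‖ ≤ B := by
    have h := norm_sub_aeval_le (subG q) ξ z hδ1
    have hdeg : Mξ ^ (subG q).natDegree ≤ Mξ ^ 3 := pow_le_pow_right₀ hMξ1 (natDegree_subG_le q)
    rw [norm_mul, hTn]
    calc (1 / 2 : ℝ) ^ m * ‖aeval z (subG q) - aeval ξ (subG q)‖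
        ≤ (1 / 2 : ℝ) ^ m * (Mξ ^ 3 * (K₀ * (1 / 2 : ℝ) ^ m)) := by
          refine mul_le_mul_of_nonneg_left (h.trans ?_) (by positivity)
          exact mul_le_mul hdeg hδ (norm_nonneg _) (by positivity)
      _ = Mξ ^ 3 * K₀ * ((1 / 2 : ℝ) ^ m * (1 / 2 : ℝ) ^ m) := by ring
      _ ≤ Mξ ^ 3 * K₀ * η := by gcongr
      _ ≤ A * η := by
          refine mul_le_mul_of_nonneg_right ?_ hη0
          have : (0 : ℝ) ≤ Mξ ^ 4 * K₀ ^ 2 + 1 := by positivity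
          rw [hA]; linarith
  -- (4) combine and divide by `t₁ = f′(ξ)`
  have hid : t₁ * (z - ξ) + T * g =
      (aeval z (edgeF q) + T * aeval z (subG q)) - (aeval z (edgeF q) - t₁ * (z - ξ))
        - T * (aeval z (subG q) - g) := by
    ring
  have h4 : ‖t₁ * (z - ξ) + T * g‖ ≤ B := by
    rw [hid]; exact ultra_sub (ultra_sub h1 h2) h3
  have hid2 : (z - ξ) + T * (g / t₁) = t₁⁻¹ * (t₁ * (z - ξ) + T * g) := by
    field_simp
  rw [hid2, norm_mul, norm_inv]
  calc ‖t₁‖⁻¹ * ‖t₁ * (z - ξ) + T * g‖ ≤ ‖t₁‖⁻¹ * B := by gcongr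
    _ = A / ‖t₁‖ * η := by rw [hB]; field_simp

/-! ### §3  The integer vector `x = (num r, 1, den r)` and the forms (tree `Lform`, `Mform` BY NAME) -/

/-- the integer vector of a sector point: `x(r) = (num r, 1, den r) ∈ ℤ³`. -/
def svec (r : ℚ) : Fin 3 → ℤ := ![r.num, 1, (r.den : ℤ)]

/-- `(r : ℚ) : svec r 0 = r.num`. -/
@[simp] theorem svec_zero (r : ℚ) : svec r 0 = r.num := rfl

/-- `(r : ℚ) : svec r 1 = 1`. -/
@[simp] theorem svec_one (r : ℚ) : svec r 1 = 1 := rfl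

/-- `(r : ℚ) : svec r 2 = (r.den : ℤ)`. -/
@[simp] theorem svec_two (r : ℚ) : svec r 2 = (r.den : ℤ) := rfl

/-- `x(r) ≠ 0` (its middle coordinate is `1`). -/
theorem svec_ne_zero (r : ℚ) : svec r ≠ 0 := by
  intro h
  have := congrFun h 1
  simp at this

/-- the real side: `∏ |L_i(x)| = |num r|·den r`. -/
theorem Lform_prod_svec (r : ℚ) :
    ∏ i, |∑ j, Lform i j * ((svec r j : ℤ) : ℝ)| = |(r.num : ℝ)| * (r.den : ℝ) := by
  rw [Fin.prod_univ_three, Lform_sum, Lform_sum, Lform_sum, svec_zero, svec_one, svec_two]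
  push_cast
  rw [abs_one, mul_one, abs_of_nonneg (by positivity : (0 : ℝ) ≤ (r.den : ℝ))]

/-- the 2-adic side: `∏ ‖M_i(x)‖₂ = ‖(num r − ξ) + den r·γ₁‖₂ · ‖den r‖₂`. -/
theorem Mform_prod_svec (ξ γ₁ : PadicAlgCl 2) (r : ℚ) :
    ∏ i, ‖∑ j, Mform ξ γ₁ i j * ((svec r j : ℤ) : PadicAlgCl 2)‖ =
      ‖((r.num : PadicAlgCl 2) - ξ) + (r.den : PadicAlgCl 2) * γ₁‖ * ‖(r.den : PadicAlgCl 2)‖ := by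
  rw [Fin.prod_univ_three, Mform_sum_zero, Mform_sum_one, Mform_sum_two, svec_zero, svec_one, svec_two]
  push_cast
  rw [norm_one, mul_one]
  congr 2
  ring

/-- the rational relation a subspace imposes: `Σ f_j x_j = f₀·num r + f₁ + f₂·den r`. -/
theorem svec_relation (f : Fin 3 → ℚ) (r : ℚ) :
    ∑ j, f j * ((svec r j : ℤ) : ℚ) = f 0 * r.num + f 1 + f 2 * r.den := by
  rw [Fin.sum_univ_three, svec_zero, svec_one, svec_two]
  push_cast
  ring

/-- `|num r| = |r| · den r`. (PORT NOTE, census-1 g25: PRIVATE — the statement is identical to the tree's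
`RootDecomp1EPointTransfer.abs_num_eq` (RootDecomp1EPointTransfer01 l.152, route 1E, outside this file's import closure);
the gate's `dedup.landed` lint forbids a public restatement (bounce p850098 of the first filing of part 02); K's proof is kept
under `private`, and part 03 carries its own private copy for its single use in `window_levels_finite`.) -/
private theorem abs_num_eq (r : ℚ) : |(r.num : ℝ)| = |(r : ℝ)| * r.den := by
  have h := Rat.mul_den_eq_num r
  have h' : ((r * (r.den : ℚ) : ℚ) : ℝ) = ((r.num : ℚ) : ℝ) := by rw [h]
  push_cast at h'
  rw [← h', abs_mul, abs_of_nonneg (by positivity : (0 : ℝ) ≤ (r.den : ℝ))]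

/-- the size of `x(r)`: `‖x‖_sup ≤ 3·max(1, C)·den r` in the window `|r| ≤ C`. -/
theorem svec_sup_le (r : ℚ) (C : ℝ) (hr : |(r : ℝ)| ≤ C) :
    ((Finset.univ.sup fun j => (svec r j).natAbs : ℕ) : ℝ) ≤ 3 * max 1 C * (r.den : ℝ) := by
  have hd1 : (1 : ℝ) ≤ r.den := by exact_mod_cast Nat.succ_le_of_lt r.den_pos
  have hC1 : 1 ≤ max 1 C := le_max_left _ _
  have h0 : ((svec r 0).natAbs : ℝ) ≤ max 1 C * (r.den : ℝ) := by
    rw [svec_zero, Nat.cast_natAbs, Int.cast_abs, abs_num_eq]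
    gcongr
    exact hr.trans (le_max_right _ _)
  have h1 : ((svec r 1).natAbs : ℝ) ≤ max 1 C * (r.den : ℝ) := by
    rw [svec_one]
    calc (((1 : ℤ).natAbs : ℕ) : ℝ) = 1 * 1 := by simp
      _ ≤ max 1 C * r.den := by gcongr
  have h2 : ((svec r 2).natAbs : ℝ) ≤ max 1 C * (r.den : ℝ) := by
    rw [svec_two, Int.natAbs_natCast]
    calc (r.den : ℝ) = 1 * r.den := by ring
      _ ≤ max 1 C * r.den := by gcongr
  have hsum : (Finset.univ.sup fun j => (svec r j).natAbs : ℕ) ≤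
      (svec r 0).natAbs + (svec r 1).natAbs + (svec r 2).natAbs := by
    refine Finset.sup_le fun j _ => ?_
    fin_cases j
    · exact (Nat.le_add_right _ _).trans (Nat.le_add_right _ _)
    · exact (Nat.le_add_left _ _).trans (Nat.le_add_right _ _)
    · exact Nat.le_add_left _ _
  calc ((Finset.univ.sup fun j => (svec r j).natAbs : ℕ) : ℝ)
      ≤ ((svec r 0).natAbs : ℝ) + ((svec r 1).natAbs : ℝ) + ((svec r 2).natAbs : ℝ) := by
        exact_mod_cast hsum
    _ ≤ max 1 C * (r.den : ℝ) + max 1 C * (r.den : ℝ) + max 1 C * (r.den : ℝ) := add_le_add (add_le_add h0 h1) h2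
    _ = 3 * max 1 C * (r.den : ℝ) := by ring

/-! ### §4  The exponent inequality of the sector (`q = 2`) -/

/-- `2^m·2^{−m} = 1`. -/
theorem two_pow_mul_half_pow_ss (n : ℕ) : (2 : ℝ) ^ n * (1 / 2 : ℝ) ^ n = 1 := by
  rw [← mul_pow]; norm_num

/-- **THE EXPONENT INEQUALITY (`ε = 1/2`).**  For every constant `G` there is `N₂` such that on every level
`N ≥ N₂` (`2m = N!`): `G·(2^m)³·(2^{−(N!−(N−1)!)})² < 1` — in base `2^{(N−1)!}` the left side is
`G·2^{(N−1)!(2 − N/2)} → 0`.  (The double product of §6 is `≤ (C K)·den·η`, its square times `‖x‖_sup ≤ 3C·den`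
is `G·den³·η²`; no failed clause is needed.) -/
theorem sector_arith (G : ℝ) : ∃ N₂ : ℕ, ∀ N m : ℕ, N₂ ≤ N → 2 * m = N ! →
    G * ((2 : ℝ) ^ m) ^ 3 * ((1 / 2 : ℝ) ^ ((N !) - (N - 1)!)) ^ 2 < 1 := by
  have hG1 : 0 < max 1 G := by positivity
  obtain ⟨t, ht⟩ := exists_pow_lt_of_lt_one (show 0 < 1 / max 1 G by positivity)
    (show (1 / 2 : ℝ) < 1 by norm_num)
  refine ⟨max t 5 + 1, fun N m hN hm => ?_⟩
  obtain ⟨M, rfl⟩ : ∃ M, N = M + 1 := ⟨N - 1, by omega⟩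
  have hMt : t ≤ M := by omega
  have hM5 : 5 ≤ M := by omega
  rw [Nat.add_sub_cancel]
  have hfac : (M + 1)! = (M + 1) * M ! := Nat.factorial_succ M
  have hsub : ((M + 1)!) - M ! = M * M ! := Nat.sub_eq_of_eq_add (by rw [hfac]; ring)
  rw [hsub]
  obtain ⟨F, hF⟩ : ∃ F, M ! = F := ⟨_, rfl⟩
  obtain ⟨Pr, hPr⟩ : ∃ Pr, M * M ! = Pr := ⟨_, rfl⟩
  have hMF : M ≤ F := by rw [← hF]; exact Nat.self_le_factorial M
  have h5F : 5 * F ≤ Pr := by rw [← hPr, ← hF]; exact Nat.mul_le_mul_right _ hM5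
  have hm' : 2 * m = Pr + F := by rw [hfac, add_mul, one_mul, hPr, hF] at hm; exact hm
  rw [hPr]
  obtain ⟨k, hk⟩ : ∃ k, m = 2 * F + k := ⟨m - 2 * F, by omega⟩
  have hkt : t ≤ k := by omega
  have hexp : Pr * 2 = m * 3 + k := by omega
  have e1 : ((1 / 2 : ℝ) ^ Pr) ^ 2 = ((1 / 2 : ℝ) ^ m) ^ 3 * (1 / 2 : ℝ) ^ k := by
    rw [← pow_mul, ← pow_mul, ← pow_add, hexp]
  have e2 : ((2 : ℝ) ^ m) ^ 3 * ((1 / 2 : ℝ) ^ m) ^ 3 = 1 := by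
    rw [← mul_pow, two_pow_mul_half_pow_ss, one_pow]
  have hkpow : (1 / 2 : ℝ) ^ k ≤ (1 / 2 : ℝ) ^ t := pow_le_pow_of_le_one (by norm_num) (by norm_num) hkt
  calc G * ((2 : ℝ) ^ m) ^ 3 * ((1 / 2 : ℝ) ^ Pr) ^ 2
      = G * (((2 : ℝ) ^ m) ^ 3 * ((1 / 2 : ℝ) ^ m) ^ 3) * (1 / 2 : ℝ) ^ k := by rw [e1]; ring
    _ = G * (1 / 2 : ℝ) ^ k := by rw [e2, mul_one]
    _ ≤ max 1 G * (1 / 2 : ℝ) ^ t := mul_le_mul (le_max_right _ _) hkpow (by positivity) hG1.le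
    _ < max 1 G * (1 / max 1 G) := mul_lt_mul_of_pos_left ht hG1
    _ = 1 := by field_simp

/-! ### §5  Closing: finitely many LEVELS per rational subspace (no Diophantine input) -/

end Summit.Schanuel.Schanuel.Theorems.RootDecomp1KSectorSubspace
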